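import Literature.NumberTheory.Transcendental.AnalytificationChartsProofs
import HarnessLib

/-!
# Analytic algebraic charts on the real or complex points of a smooth scheme

Let `k` be a field, `𝕜 = ℝ` or `ℂ` (Mathlib `RCLike 𝕜`) a `k`-algebra (the cases of interest:
`k ⊆ ℝ = 𝕜`, real points; `k ⊆ ℂ = 𝕜`, complex points), and `X` a `k`-scheme smooth of relative
dimension `d` (Mathlib `SmoothOfRelativeDimension d X.hom`). The set `X(𝕜)` of `𝕜`-valued points
carries the strong topology of `Literature.AlgebraicGeometry.Motives.AlgPoints`. This file proves,
for both `𝕜` at once: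

* `exists_implicitChart_of_rclike` — the **analytic implicit function theorem for polynomial
  equations** over `𝕜`: the zero set of polynomials `F₁, …, F_r ∈ 𝕜[xᵢ]` whose Jacobian minor with
  respect to `r` of the variables is non-zero at a point `z₀` of it is, near `z₀`, the graph of an
  analytic map over an open subset of the space of the remaining `d` variables (Serre, GAGA §1 n°4,
  "points simples"; Bochnak–Coste–Roy, *Real Algebraic Geometry*, Cor. 2.9.8 / Prop. 3.3.11 for
  `𝕜 = ℝ`: the nonsingular points of a real algebraic set form an analytic, indeed Nash, manifold).
  The proof is that of the tree's complex version
  `Literature.NumberTheory.Transcendental.exists_implicitChart` (Mathlib's inverse function theorem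
  `ContDiffAt.toOpenPartialHomeomorph` in smoothness `ω`, stated in Mathlib for `RCLike` scalars),
  which is valid verbatim for `𝕜 = ℝ`; only the scalars change.
* `exists_analyticAlgebraicChart` — **analytic algebraic charts**: every `P₀ ∈ X(𝕜)` lies in the
  source of an open partial homeomorphism `e : X(𝕜) → 𝕜ᵈ` whose coordinates are regular functions
  `x₁, …, x_d ∈ Γ(X, V)` on an affine open `V` (étale coordinates of a standard smooth
  presentation of `Γ(X, V)`), and in which every regular function on every affine open is
  `𝕜`-analytic (locally a quotient of polynomials in the analytic inverse of the chart). For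
  `𝕜 = ℂ` this is the tree's `Literature.NumberTheory.Transcendental.exists_algebraicChart_holds`
  (Serre, GAGA §2 n°5 Prop. 2, n°6 Prop. 3 Cor. 2); for `𝕜 = ℝ` it is the statement that the real
  points of a smooth `k`-scheme, `k ⊆ ℝ`, form a real-analytic manifold of dimension `d` with
  algebraic local coordinates in which regular functions are real-analytic (Bochnak–Coste–Roy
  Prop. 3.3.11 with §3.4; Akbulut–King, *Topology of Real Algebraic Sets*, Ch. II §§2–3). The
  scheme-theoretic inputs are the tree's field-independent lemmas of
  `Literature.NumberTheory.Transcendental.AnalytificationChartsProofs`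
  (`AlgPoints.exists_isStandardSmoothOfRelativeDimension_scalarRingHom`,
  `AlgPoints.isInducing_evalOrZero_val`, `AlgPoints.exists_evalOrZero_val_eq`,
  `AlgPoints.eq_of_evalOrZero_val_eq`, `AlgPoints.det_ne_zero_of_submersivePresentation`,
  `AlgPoints.exists_fraction`), and the proof follows the complex one step by step.

This is the first, local, layer of the construction of the real Abel–Jacobi package of a curve
over a real-algebraic field (`Literature.AlgebraicGeometry.RealAlgebraic.RealAbelJacobi`,
named fact `RealAbelJacobi.exists_realization`): the `C^∞` (indeed `C^ω`) submanifold structure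
of `C(ℝ)` and `J(ℝ)`. No named fact is introduced; everything is proved.

## References

* J.-P. Serre, *Géométrie algébrique et géométrie analytique*, Ann. Inst. Fourier **6** (1956),
  §1 n°4, §2 n°5 (Lemme 1, Prop. 2), n°6 (Prop. 3, Cor. 2). [SerreGAGA1956]
* J. Bochnak, M. Coste, M.-F. Roy, *Real Algebraic Geometry*, Springer 1998, Cor. 2.9.8,
  Prop. 3.3.11, §3.4. [BochnakCosteRoy1998]
* S. Akbulut, H. King, *Topology of Real Algebraic Sets*, MSRI Publ. 25, Springer 1992, Ch. II
  §§2–3. [AkbulutKing1992]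
-/

noncomputable section

universe u

open CategoryTheory AlgebraicGeometry MvPolynomial Set
open _root_.Topology
open scoped ContDiff Matrix

namespace Literature.AlgebraicGeometry.RealAlgebraic

open Literature.AlgebraicGeometry.Motives Literature.NumberTheory.Transcendental

/-! ### The analytic implicit function theorem for polynomial equations over `ℝ` or `ℂ` -/

section Implicit

variable {𝕜 : Type*} [RCLike 𝕜]
variable {ι σ τ : Type*} [Fintype ι] [Fintype σ] [Fintype τ]

/-- **Analytic implicit function theorem for polynomial equations over `𝕜 = ℝ` or `ℂ`.** Let the
coordinates of `𝕜^ι` be split as `E : τ ⊕ σ ≃ ι`, let `F = (F_j)_{j ∈ σ}` be polynomials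
over `𝕜` in the variables `ι`, and let `z₀ ∈ 𝕜^ι` be a point at which the Jacobian minor
`det ((∂F_j/∂x_{E(inr i)})(z₀))_{i j}` with respect to the `σ`-variables is non-zero. Then there
are an open neighbourhood `Ω` of `z₀`, an open set `T ⊆ 𝕜^τ` and a map `ψ : 𝕜^τ → 𝕜^ι`, analytic
at every point of `T`, such that the projection `z ↦ (z_{E(inl t)})_t` to the free coordinates
maps `{F = 0} ∩ Ω` bijectively onto `T` with inverse `ψ`. For `𝕜 = ℂ` this is the tree's
`Literature.NumberTheory.Transcendental.exists_implicitChart` (Serre, GAGA §1 n°4), whose proof —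
Mathlib's inverse function theorem for `G = (π_τ, F)` in smoothness `ω` (`RCLike` scalars) — is
repeated here for `𝕜 = ℝ` or `ℂ`; for `𝕜 = ℝ` it is the analytic (Nash) manifold
structure of a real algebraic set at its nonsingular points (Bochnak–Coste–Roy, Cor. 2.9.8 and
Prop. 3.3.11). [cite: BochnakCosteRoy1998, Cor. 2.9.8 and Prop. 3.3.11] -/
theorem exists_implicitChart_of_rclike [DecidableEq σ] (E : τ ⊕ σ ≃ ι)
    (F : σ → MvPolynomial ι 𝕜) (z₀ : ι → 𝕜)
    (hJ : (Matrix.of fun i j : σ ↦ eval z₀ (pderiv (E (Sum.inr i)) (F j))).det ≠ 0) :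
    ∃ (Ω : Set (ι → 𝕜)) (T : Set (τ → 𝕜)) (ψ : (τ → 𝕜) → (ι → 𝕜)),
      IsOpen Ω ∧ z₀ ∈ Ω ∧ IsOpen T ∧ AnalyticOnNhd 𝕜 ψ T ∧
      (∀ z ∈ Ω, (∀ j, eval z (F j) = 0) →
        (fun t ↦ z (E (Sum.inl t))) ∈ T ∧ ψ (fun t ↦ z (E (Sum.inl t))) = z) ∧
      (∀ w ∈ T, ψ w ∈ Ω ∧ (∀ j, eval (ψ w) (F j) = 0) ∧
        (fun t ↦ ψ w (E (Sum.inl t))) = w) := by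
  classical
  -- the projection to the free coordinates and the map `G = (π, F)`
  let π : (ι → 𝕜) →L[𝕜] (τ → 𝕜) :=
    ContinuousLinearMap.pi fun t ↦ ContinuousLinearMap.proj (E (Sum.inl t))
  have hπ : ∀ z : ι → 𝕜, π z = fun t ↦ z (E (Sum.inl t)) := fun z ↦ rfl
  let G : (ι → 𝕜) → (τ → 𝕜) × (σ → 𝕜) := fun z ↦ (π z, fun j ↦ eval z (F j))
  have hGzero : ∀ z : ι → 𝕜, (∀ j, eval z (F j) = 0) →
      G z = ((fun t ↦ z (E (Sum.inl t))), 0) := fun z hz ↦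
    Prod.ext (hπ z) (funext hz)
  -- its derivative at `z₀`
  let D : (ι → 𝕜) →L[𝕜] (σ → 𝕜) := ContinuousLinearMap.pi fun j ↦
    ∑ i, eval z₀ (pderiv i (F j)) • (ContinuousLinearMap.proj i : (ι → 𝕜) →L[𝕜] 𝕜)
  have hG : HasFDerivAt G (π.prod D) z₀ := by
    refine π.hasFDerivAt.prodMk ?_
    exact hasFDerivAt_pi.mpr fun j ↦ by
      simpa [D] using hasFDerivAt_eval (F j) z₀
  -- the derivative is injective (the Jacobian minor is invertible) ...
  have hinj : Function.Injective (π.prod D) := by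
    refine (injective_iff_map_eq_zero _).mpr fun v hv ↦ ?_
    have hv1 : ∀ t, v (E (Sum.inl t)) = 0 := fun t ↦ by
      have := congr_arg Prod.fst hv
      exact congr_fun this t
    have hv2 : ∀ j, ∑ i, eval z₀ (pderiv i (F j)) * v i = 0 := fun j ↦ by
      have := congr_fun (congr_arg Prod.snd hv) j
      simpa [D] using this
    set u : σ → 𝕜 := fun i ↦ v (E (Sum.inr i)) with hu
    have huJ : u ᵥ* (Matrix.of fun i j : σ ↦ eval z₀ (pderiv (E (Sum.inr i)) (F j))) = 0 := by
      funext j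
      rw [Matrix.vecMul, dotProduct]
      have h := hv2 j
      rw [← Equiv.sum_comp E, Fintype.sum_sum_type] at h
      simp only [hv1, mul_zero, Finset.sum_const_zero, zero_add] at h
      simpa [Matrix.of_apply, hu, mul_comm] using h
    have hu0 : u = 0 := Matrix.eq_zero_of_vecMul_eq_zero hJ huJ
    funext i
    obtain ⟨s, rfl⟩ := E.surjective i
    rcases s with t | j
    · exact hv1 t
    · exact congr_fun hu0 j
  -- ... hence bijective, by a dimension count
  have hrank : Module.finrank 𝕜 (ι → 𝕜) = Module.finrank 𝕜 ((τ → 𝕜) × (σ → 𝕜)) := by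
    simp only [Module.finrank_prod, Module.finrank_fintype_fun_eq_card]
    rw [← Fintype.card_sum]
    exact Fintype.card_congr E.symm
  have hbij : Function.Bijective (π.prod D) :=
    ⟨hinj, (LinearMap.injective_iff_surjective_of_finrank_eq_finrank hrank
      (f := (π.prod D).toLinearMap)).mp hinj⟩
  let Geq : (ι → 𝕜) ≃L[𝕜] ((τ → 𝕜) × (σ → 𝕜)) :=
    (LinearEquiv.ofBijective (π.prod D).toLinearMap hbij).toContinuousLinearEquiv
  have hG' : HasFDerivAt G (Geq : (ι → 𝕜) →L[𝕜] ((τ → 𝕜) × (σ → 𝕜))) z₀ := by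
    convert hG using 1
    ext1 v
    simp [Geq]
  -- `G` is analytic
  have hGc : ContDiffAt 𝕜 ω G z₀ := by
    refine π.contDiff.contDiffAt.prodMk ?_
    exact contDiffAt_pi.mpr fun j ↦ contDiffAt_eval (F j) z₀
  have hn : (ω : WithTop ℕ∞) ≠ 0 := by simp
  -- the inverse function theorem
  let Φ := hGc.toOpenPartialHomeomorph G hG' hn
  have hΦ : (Φ : (ι → 𝕜) → (τ → 𝕜) × (σ → 𝕜)) = G := rfl
  have hz₀Φ : z₀ ∈ Φ.source := hGc.mem_toOpenPartialHomeomorph_source hG' hn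
  have hsymm : ContDiffAt 𝕜 ω Φ.symm (G z₀) := hGc.to_localInverse hG' hn
  -- the open set where the local inverse is analytic
  let N : Set ((τ → 𝕜) × (σ → 𝕜)) := Φ.target ∩ {y | AnalyticAt 𝕜 Φ.symm y}
  have hN : IsOpen N := Φ.open_target.inter (isOpen_analyticAt 𝕜 Φ.symm)
  have hz₀N : G z₀ ∈ N := ⟨Φ.map_source hz₀Φ, hsymm.analyticAt⟩
  let Ω : Set (ι → 𝕜) := Φ.source ∩ G ⁻¹' N
  let emb : (τ → 𝕜) → (τ → 𝕜) × (σ → 𝕜) := fun w ↦ (w, 0)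
  have hemb : Continuous emb := continuous_id.prodMk continuous_const
  have hemb' : ∀ w, AnalyticAt 𝕜 emb w := fun w ↦ analyticAt_id.prod analyticAt_const
  let T : Set (τ → 𝕜) := emb ⁻¹' N
  let ψ : (τ → 𝕜) → (ι → 𝕜) := fun w ↦ Φ.symm (emb w)
  refine ⟨Ω, T, ψ, Φ.isOpen_inter_preimage hN, ⟨hz₀Φ, hz₀N⟩, hN.preimage hemb,
    fun w hw ↦ (hw.2).comp (hemb' w), fun z hz hFz ↦ ?_, fun w hw ↦ ?_⟩
  · have hGz : G z = emb (fun t ↦ z (E (Sum.inl t))) := hGzero z hFz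
    refine ⟨?_, ?_⟩
    · change emb _ ∈ N
      rw [← hGz]
      exact hz.2
    · change Φ.symm (emb _) = z
      rw [← hGz, ← hΦ]
      exact Φ.left_inv hz.1
  · have hwt : emb w ∈ Φ.target := hw.1
    have hsrc : ψ w ∈ Φ.source := Φ.map_target hwt
    have hGψ : G (ψ w) = emb w := by
      rw [← hΦ]
      exact Φ.right_inv hwt
    refine ⟨⟨hsrc, ?_⟩, fun j ↦ ?_, ?_⟩
    · change G (ψ w) ∈ N
      rw [hGψ]
      exact hw
    · have := congr_fun (congr_arg Prod.snd hGψ) j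
      simpa [G, emb] using this
    · have := congr_arg Prod.fst hGψ
      simpa [G, emb, hπ] using this

end Implicit

/-! ### Analytic algebraic charts of `X(𝕜)` -/

section Charts

variable {k : Type u} [Field k] {𝕜 : Type u} [RCLike 𝕜] [Algebra k 𝕜]

/-- **Analytic algebraic charts of the `𝕜`-points of a smooth scheme** (`𝕜 = ℝ` or `ℂ`). Let `𝕜`
be `ℝ` or `ℂ` (`RCLike 𝕜`), a `k`-algebra, and `X` a `k`-scheme smooth of relative dimension `d`. Every point `P₀ ∈ X(𝕜)` (strong topology) lies in the source of an open partial homeomorphism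
`e` from `X(𝕜)` to `𝕜ᵈ` such that
(i) the coordinates of `e` are regular functions: there are an affine open `V ⊆ X` with
`e.source ⊆ V(𝕜)` and `x₁, …, x_d ∈ Γ(X, V)` with `e(P) = (x₁(P), …, x_d(P))` on `e.source`;
(ii) every regular function `s ∈ Γ(X, U)` on every affine open `U` is `𝕜`-analytic in the chart:
`s ∘ e⁻¹` is analytic at every point of the open set `e.target ∩ e⁻¹⁻¹(U(𝕜))`.
Proof, following Serre (GAGA §2 n°5–6) exactly as in the complex case
`Literature.NumberTheory.Transcendental.exists_algebraicChart_holds`: a standard smooth affine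
neighbourhood `V` of `P₀` with a submersive presentation `Γ(X, V) = k[xᵢ]/(F_j)`; its generators
embed `V(𝕜)` onto the zero set of `F^𝕜` in `𝕜^ι` with non-vanishing Jacobian minor; the analytic
implicit function theorem `exists_implicitChart_of_rclike` inverts the projection to `d`
free coordinates; a regular function is locally `g/fⁿ` with `f, g` polynomials in the `xᵢ`. For
`𝕜 = ℝ`, `k ⊆ ℝ`: the real points of a smooth `k`-scheme of relative dimension `d` form a
real-analytic `d`-manifold with algebraic local coordinates, in which regular functions are
real-analytic (Bochnak–Coste–Roy Prop. 3.3.11: nonsingular points of a real algebraic set; Serre,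
GAGA §2 n°5 Prop. 2 for the formalism of algebraic charts).
[cite: SerreGAGA1956, §2 n°5 Prop. 2 and n°6 Prop. 3 Cor. 2] [cite: BochnakCosteRoy1998, Prop. 3.3.11] -/
theorem exists_analyticAlgebraicChart (X : SchemeOver k) (d : ℕ)
    [SmoothOfRelativeDimension d X.hom] (P₀ : AlgPoints X 𝕜) :
    ∃ e : OpenPartialHomeomorph (AlgPoints X 𝕜) (Fin d → 𝕜),
      P₀ ∈ e.source ∧
      (∃ (U : X.left.affineOpens) (x : Fin d → Γ(X.left, ↑U)),
        e.source ⊆ {P | P.pt ∈ (↑U : X.left.Opens)} ∧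
        ∀ P ∈ e.source, ∀ i, e P i = AlgPoints.evalOrZero ↑U (x i) P) ∧
      ∀ (U : X.left.affineOpens) (s : Γ(X.left, ↑U)),
        AnalyticOnNhd 𝕜 (AlgPoints.evalOrZero ↑U s ∘ e.symm)
          (e.target ∩ e.symm ⁻¹' {P | P.pt ∈ (↑U : X.left.Opens)}) := by
  classical
  -- Step 1: a standard smooth affine neighbourhood `V` of `P₀` and a submersive presentation
  obtain ⟨V, hV, hP₀V, hsm⟩ :=
    AlgPoints.exists_isStandardSmoothOfRelativeDimension_scalarRingHom d P₀
  letI : Algebra k Γ(X.left, V) := (SchemeOver.scalarRingHom X V).toAlgebra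
  have halg : ∀ c, algebraMap k Γ(X.left, V) c = SchemeOver.scalarRingHom X V c := fun c ↦ rfl
  obtain ⟨ι, σ, _, _, P, hPd⟩ := hsm.out
  letI := Fintype.ofFinite ι
  letI := Fintype.ofFinite σ
  -- Step 2: coordinates and equations over `𝕜`
  set x : AlgPoints X 𝕜 → ι → 𝕜 := fun Q i ↦ AlgPoints.evalOrZero V (P.val i) Q with hx
  let F : σ → MvPolynomial ι 𝕜 := fun j ↦ MvPolynomial.map (algebraMap k 𝕜) (P.relation j)
  have hPd' : Fintype.card ι - Fintype.card σ = d := by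
    simpa [Algebra.Presentation.dimension, Nat.card_eq_fintype_card] using hPd
  obtain ⟨E, hE⟩ := exists_equiv_sum_of_card_eq P.map P.map_inj hPd'
  have hJ : (Matrix.of fun i j : σ ↦ eval (x P₀) (pderiv (E (Sum.inr i)) (F j))).det ≠ 0 := by
    simp_rw [hE]
    exact AlgPoints.det_ne_zero_of_submersivePresentation halg P hP₀V
  -- Step 3: the implicit function theorem
  obtain ⟨Ω, T, ψ, hΩ, hz₀Ω, hT, hψ, hΩZ, hTZ⟩ := exists_implicitChart_of_rclike E F (x P₀) hJ
  have hZ : ∀ Q : AlgPoints X 𝕜, Q.pt ∈ V → ∀ j, eval (x Q) (F j) = 0 :=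
    fun Q hQ j ↦ AlgPoints.eval_map_relation_eq_zero halg P.toPresentation hQ j
  have hsurj : ∀ z, (∀ j, eval z (F j) = 0) → ∃ Q : AlgPoints X 𝕜, Q.pt ∈ V ∧ x Q = z :=
    fun z hz ↦ AlgPoints.exists_evalOrZero_val_eq halg hV P.toPresentation z hz
  have hinj : ∀ Q Q' : AlgPoints X 𝕜, Q.pt ∈ V → Q'.pt ∈ V → x Q = x Q' → Q = Q' :=
    fun Q Q' hQ hQ' e ↦ AlgPoints.eq_of_evalOrZero_val_eq halg hV P.toGenerators hQ hQ' e
  have hind : IsInducing fun Q : {Q : AlgPoints X 𝕜 // Q.pt ∈ V} ↦ x Q.1 :=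
    AlgPoints.isInducing_evalOrZero_val halg hV P.toGenerators
  have hxc : ContinuousOn x {Q | Q.pt ∈ V} := AlgPoints.continuousOn_evalOrZero_pi P.val
  -- Step 4: the chart
  let inv : (Fin d → 𝕜) → AlgPoints X 𝕜 := fun w ↦
    if h : ∃ Q : AlgPoints X 𝕜, Q.pt ∈ V ∧ x Q = ψ w then h.choose else P₀
  have hinv : ∀ w ∈ T, (inv w).pt ∈ V ∧ x (inv w) = ψ w := fun w hw ↦ by
    have h : ∃ Q : AlgPoints X 𝕜, Q.pt ∈ V ∧ x Q = ψ w := hsurj (ψ w) (hTZ w hw).2.1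
    simp only [inv, dif_pos h]
    exact h.choose_spec
  let π : (ι → 𝕜) → (Fin d → 𝕜) := fun z t ↦ z (E (Sum.inl t))
  have hπ : Continuous π := continuous_pi fun t ↦ continuous_apply _
  let e : OpenPartialHomeomorph (AlgPoints X 𝕜) (Fin d → 𝕜) :=
  { toFun := fun Q ↦ π (x Q)
    invFun := inv
    source := {Q | Q.pt ∈ V} ∩ x ⁻¹' Ω
    target := T
    map_source' := fun Q hQ ↦ (hΩZ (x Q) hQ.2 (hZ Q hQ.1)).1
    map_target' := fun w hw ↦ ⟨(hinv w hw).1, by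
      change x (inv w) ∈ Ω
      rw [(hinv w hw).2]
      exact (hTZ w hw).1⟩
    left_inv' := fun Q hQ ↦ by
      have h1 := hΩZ (x Q) hQ.2 (hZ Q hQ.1)
      have h2 := hinv (π (x Q)) h1.1
      exact hinj _ _ h2.1 hQ.1 (h2.2.trans h1.2)
    right_inv' := fun w hw ↦ by
      rw [(hinv w hw).2]
      exact (hTZ w hw).2.2
    open_source := hxc.isOpen_inter_preimage (AlgPoints.isOpen_setOf_pt_mem V) hΩ
    open_target := hT
    continuousOn_toFun := (hπ.comp_continuousOn hxc).mono Set.inter_subset_left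
    continuousOn_invFun := by
      rw [continuousOn_iff_continuous_restrict]
      have h1 : Continuous fun w : T ↦
          (⟨inv w, (hinv w w.2).1⟩ : {Q : AlgPoints X 𝕜 // Q.pt ∈ V}) := by
        rw [hind.continuous_iff]
        have : ((fun Q : {Q : AlgPoints X 𝕜 // Q.pt ∈ V} ↦ x Q.1) ∘ fun w : T ↦
            (⟨inv w, (hinv w w.2).1⟩ : {Q : AlgPoints X 𝕜 // Q.pt ∈ V})) = T.restrict ψ := by
          funext w
          exact (hinv w w.2).2
        rw [this]
        exact continuousOn_iff_continuous_restrict.mp hψ.continuousOn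
      exact continuous_subtype_val.comp h1 }
  have he_symm : ∀ w, e.symm w = inv w := fun w ↦ rfl
  refine ⟨e, ⟨hP₀V, hz₀Ω⟩, ⟨⟨V, hV⟩, fun t ↦ P.val (E (Sum.inl t)), fun Q hQ ↦ hQ.1,
    fun Q _ t ↦ rfl⟩, ?_⟩
  -- Step 5: regular functions are analytic in the chart
  intro U' s
  rintro w₁ ⟨hw₁T, hw₁U'⟩
  have hQ₁ := hinv w₁ hw₁T
  obtain ⟨f, g, n, hle, hQ₁f, Hfrac⟩ :=
    AlgPoints.exists_fraction (L := 𝕜) hV s hQ₁.1 hw₁U'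
  let fK : MvPolynomial ι 𝕜 := MvPolynomial.map (algebraMap k 𝕜) (P.σ f)
  let gK : MvPolynomial ι 𝕜 := MvPolynomial.map (algebraMap k 𝕜) (P.σ g)
  have hfK : ∀ (Q : AlgPoints X 𝕜) (hQ : Q.pt ∈ V), Q.eval V hQ f = eval (x Q) fK :=
    fun Q hQ ↦ AlgPoints.eval_eq_eval_map_σ halg P.toGenerators hQ f
  have hgK : ∀ (Q : AlgPoints X 𝕜) (hQ : Q.pt ∈ V), Q.eval V hQ g = eval (x Q) gK :=
    fun Q hQ ↦ AlgPoints.eval_eq_eval_map_σ halg P.toGenerators hQ g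
  -- the neighbourhood `{w ∈ T | f(ψ w) ≠ 0}` of `w₁`
  let N₁ : Set (Fin d → 𝕜) := T ∩ (fun w ↦ eval (ψ w) fK) ⁻¹' {a | a ≠ 0}
  have hN₁ : IsOpen N₁ :=
    ((MvPolynomial.continuous_eval fK).comp_continuousOn hψ.continuousOn).isOpen_inter_preimage
      hT isOpen_ne
  have hf₁ : eval (ψ w₁) fK ≠ 0 := by
    rw [← hQ₁.2, ← hfK _ hQ₁.1]
    exact (AlgPoints.eval_ne_zero_iff_mem_basicOpen _ V hQ₁.1 f).mpr hQ₁f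
  have hw₁N₁ : w₁ ∈ N₁ := ⟨hw₁T, hf₁⟩
  have hanalytic : AnalyticAt 𝕜 (fun w ↦ eval (ψ w) gK / eval (ψ w) fK ^ n) w₁ := by
    have hψ₁ : AnalyticAt 𝕜 ψ w₁ := hψ w₁ hw₁T
    refine (((AnalyticOnNhd.eval_mvPolynomial gK) _ (Set.mem_univ _)).comp hψ₁).div
      ((((AnalyticOnNhd.eval_mvPolynomial fK) _ (Set.mem_univ _)).comp hψ₁).pow n) ?_
    exact pow_ne_zero n hf₁
  refine hanalytic.congr ?_
  filter_upwards [hN₁.mem_nhds hw₁N₁] with w hw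
  obtain ⟨hwT, hwf⟩ := hw
  obtain ⟨hQV, hxQ⟩ := hinv w hwT
  have hwf' : eval (x (inv w)) fK ≠ 0 := by
    rw [hxQ]
    exact hwf
  have hQf : (inv w).pt ∈ X.left.basicOpen f := by
    refine (AlgPoints.eval_ne_zero_iff_mem_basicOpen _ V hQV f).mp ?_
    rw [hfK _ hQV]
    exact hwf'
  have H := Hfrac (inv w) hQf
  rw [hfK _ hQV, hgK _ hQV, hxQ] at H
  rw [Function.comp_apply, he_symm, AlgPoints.evalOrZero_of_mem s (hle hQf), ← H,
    mul_div_assoc, div_self (pow_ne_zero n hwf), mul_one]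

/-- **Real points of a smooth scheme are a real-analytic manifold (chart form).** The case
`𝕜 = ℝ` of `exists_analyticAlgebraicChart`, with the conclusion (ii) in the `C^ω` form used by
Mathlib's manifold library: for `k ⊆ ℝ` and `X` a `k`-scheme smooth of relative dimension `d`,
every real point lies in a chart of `X(ℝ)` onto an open subset of `ℝᵈ` with regular coordinates,
in which all regular functions on affine opens are `C^ω`. (Bochnak–Coste–Roy Prop. 3.3.11:
`x ∈ Nonsing(V)` iff a neighbourhood of `x` in `V` is a `d`-dimensional Nash — in particular
analytic — submanifold.) [cite: BochnakCosteRoy1998, Prop. 3.3.11] -/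
theorem exists_realAlgebraicChart {k : Type} [Field k] [Algebra k ℝ] (X : SchemeOver k) (d : ℕ)
    [SmoothOfRelativeDimension d X.hom] (P₀ : AlgPoints X ℝ) :
    ∃ e : OpenPartialHomeomorph (AlgPoints X ℝ) (Fin d → ℝ),
      P₀ ∈ e.source ∧
      (∃ (U : X.left.affineOpens) (x : Fin d → Γ(X.left, ↑U)),
        e.source ⊆ {P | P.pt ∈ (↑U : X.left.Opens)} ∧
        ∀ P ∈ e.source, ∀ i, e P i = AlgPoints.evalOrZero ↑U (x i) P) ∧
      ∀ (U : X.left.affineOpens) (s : Γ(X.left, ↑U)),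
        ContDiffOn ℝ ω (AlgPoints.evalOrZero ↑U s ∘ e.symm)
          (e.target ∩ e.symm ⁻¹' {P | P.pt ∈ (↑U : X.left.Opens)}) := by
  obtain ⟨e, h₀, hcoord, han⟩ := exists_analyticAlgebraicChart X d P₀
  exact ⟨e, h₀, hcoord, fun U s ↦ (han U s).contDiffOn_of_completeSpace⟩

end Charts

end Literature.AlgebraicGeometry.RealAlgebraic

end
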